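import Literature.Probability.RandomPlanarGeometry.CritPercSLESimplePathProofs
import Literature.Probability.RandomPlanarGeometry.SLETraceContinuity
import HarnessLib

/-!
# The simple phase `κ ≤ 4` (Rohde–Schramm Thm. 6.1): assembly down to Cor. 3.5

Topic `Probability/RandomPlanarGeometry`; theorems only (no new named fact). The target fact
`Literature.Probability.RandomPlanarGeometry.ae_isSimpleTrace_sleTrace_of_le_four` (`CritPercSLE.lean`;
Rohde–Schramm, *Basic properties of SLE*, Ann. Math. 161 (2005), Thm. 6.1: for `0 < κ ≤ 4` the
SLE_κ trace is a.s. a simple path in `ℍ ∪ {0}`) is reduced in the tree as follows: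

* `ae_isSimpleTrace_sleTrace_of_le_four_of_thm36` (`CritPercSLESimplePathProofs.lean`): the
  printed proof of Thm. 6.1 — Lemma 6.2 (`κ ≤ 4` ⇒ no real point is swallowed, the discharged
  fact `sle_swallowingTime_ofReal_eq_top_holds`, Lawler (2005) Prop. 6.8), the Markov shift
  `ĝ_t = g_{t+s} ∘ g_s⁻¹(· + ξ(s)) - ξ(s)` (Prop. 2.1 (ii)) over rational `s`, and the strict growth
  of the hulls — leaves exactly one stochastic input, the existence of the trace (Thm. 5.1,
  `hasSLETrace_of_ne_eight`), i.e. Thm. 3.6 (`RohdeSchramm2005_thm36`) by the proved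
  deterministic criterion Thm. 4.1 (`hasSLETrace_of_ne_eight_of_thm36`);
* `RohdeSchramm2005_thm36_of_cor35` (`SLETraceContinuity.lean`): Thm. 3.6 from the one-point
  derivative estimate **Cor. 3.5** on the canonical space
  (`RohdeSchramm2005_cor35 Process.preWienerMeasure`, `SLEDerivativeEstimates.lean`) — Borel–Cantelli
  on the dyadic grid, Lévy's modulus for the driving function, Koebe distortion and the chaining
  of pp. 897–898, scale invariance.

Composing the two: **Thm. 6.1 follows from Cor. 3.5 alone**
(`ae_isSimpleTrace_sleTrace_of_le_four_of_cor35`), and, for the record, from trace existence in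
the simple range only (`ae_isSimpleTrace_sleTrace_of_le_four_of_hasSLETrace_le_four`: it suffices
that SLE_κ be a.s. generated by a curve for every `0 < κ ≤ 4`). The discharge
`ae_isSimpleTrace_sleTrace_of_le_four_holds` is then the one-liner
`ae_isSimpleTrace_sleTrace_of_le_four_of_cor35 RohdeSchramm2005_cor35_holds` once Cor. 3.5
(Thm. 3.2: Itô's formula for the time-changed backward flow, Lemma 3.1 and the Schwarz lemma) is
proved in the tree.

## References

* S. Rohde, O. Schramm, *Basic properties of SLE*, Ann. of Math. 161 (2005) 883–924: Lemma 3.1,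
  Thm. 3.2, Cor. 3.5 (p. 894), Thm. 3.6 (pp. 895–898), Thm. 4.1, Thm. 5.1, Lemma 6.2 and Thm. 6.1
  (pp. 901–902).
* G. F. Lawler, *Conformally Invariant Processes in the Plane*, AMS (2005), Prop. 6.8, Prop. 6.9.
-/

noncomputable section

open MeasureTheory
open scoped NNReal

namespace Literature.Probability.RandomPlanarGeometry

/-- **Rohde–Schramm's Thm. 6.1 from Cor. 3.5 alone.** If the one-point derivative estimate
Cor. 3.5 holds for the canonical Brownian motion (`RohdeSchramm2005_cor35 preWienerMeasure`), then
for `0 < κ ≤ 4` the SLE_κ trace is almost surely a simple trace: Cor. 3.5 ⇒ Thm. 3.6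
(`RohdeSchramm2005_thm36_of_cor35`) ⇒ Thm. 5.1 (`hasSLETrace_of_ne_eight_of_thm36`) ⇒ Thm. 6.1
(`ae_isSimpleTrace_sleTrace_of_le_four_of_thm36`). [cite: RohdeSchramm2005, Thm 6.1] -/
theorem ae_isSimpleTrace_sleTrace_of_le_four_of_cor35 {κ : ℝ≥0}
    (h : RohdeSchramm2005_cor35 Process.preWienerMeasure) :
    ae_isSimpleTrace_sleTrace_of_le_four (κ := κ) :=
  ae_isSimpleTrace_sleTrace_of_le_four_of_thm36 (RohdeSchramm2005_thm36_of_cor35 h)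

/-- **Thm. 6.1 from trace existence in the simple range.** If SLE_κ is almost surely generated by
a curve for every `0 < κ ≤ 4`, then `ae_isSimpleTrace_sleTrace_of_le_four` holds at every `κ`
(the statement is vacuous outside `0 < κ ≤ 4`); this is `ae_isSimpleTrace_sleTrace_of_hasSLETrace`
with the quantifiers arranged as in the target. [cite: RohdeSchramm2005, Thm 6.1] -/
theorem ae_isSimpleTrace_sleTrace_of_le_four_of_hasSLETrace_le_four {κ : ℝ≥0}
    (h : ∀ κ' : ℝ≥0, 0 < κ' → κ' ≤ 4 → HasSLETrace κ') :
    ae_isSimpleTrace_sleTrace_of_le_four (κ := κ) :=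
  fun h0 h4 ↦ ae_isSimpleTrace_sleTrace_of_hasSLETrace (h κ h0 h4) h4

end Literature.Probability.RandomPlanarGeometry
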